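import Literature.Barriers.CriticalPhenomena.LaceExpansionFractionalSmear
import HarnessLib

/-!
# `L^p` bounds for dyadic second-difference smears from slice bounds of Hara's type
# (towards Hara 2008, Lemma 1.7 with non-integer exponents)

Support file for the analytic named fact `Hara2008_lemma17Pc` (`LaceExpansionXSpaceNorms.lean`),
sequel of `LaceExpansionFractionalSmear.lean`. There the weight `w_θ(x_l) ≍ |x_l|^θ` was given the
Fourier representative `T_θ F = Σ_n 2^{nθ} Δ²_{h_n} F` (dyadic second differences along `e_l`,
`h_n = π/2^{n+2}`). Here we bound `T_θ F` in `L^p([-π,π]^d)` when `F` obeys bounds of the shape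
produced by Hara's Lemma 4.1 for `F = ∂_l^m Ĝ`: `|F(k)| ≤ C|k|^{-a}` and, along the slices
`s ↦ F(ins_l(s,k'))`, `|∂_s^r F| ≤ C|k|^{-a-r}` (`r = 1` or `2`). The mechanism is the `L^p`-modulus
of smoothness ([folklore]): splitting the cube at `|k| ≈ 3h`,

  `∫_{[-π,π]^d} |Δ²_h F|^p ≲ ∫_{|k| < 4h} |k|^{-ap} + h^{rp} ∫_{|k| ≥ 3h} |k|^{-(a+r)p} ≲ h^{q - ap}`

for any `q ∈ [ap, (a+r)p]` with `q < d` (`lintegral_rpow_sdiff_le`), whence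
`‖T_θ F‖_p ≤ Σ_n 2^{nθ} ‖Δ²_{h_n}F‖_p < ∞` as soon as `θ < r` and `(a + θ)p < d`
(`lintegral_rpow_smear_lt_top`): the `k`-space integrability "finite for `2 + α < d`" of Hara's
(4.9), (4.17) with `α = a - 2 + θ` fractional, without fractional derivatives.

## References

* T. Hara, Ann. Probab. 36 (2008) 530–593 (arXiv:math-ph/0504021): §4.1.3 ((4.16)–(4.17): "finite as
  long as … `2 + n - ε < d`"), §4.3.
-/

noncomputable section

namespace Literature.Barriers.CriticalPhenomena

open _root_.MeasureTheory _root_.Filter _root_.Topology Finset Literature.Probability.LatticeModels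
  Literature.Probability.Percolation

open scoped ENNReal NNReal

namespace FracSmear

variable {n : ℕ}

/-! ### Geometry of shifts and slices -/

/-- `|k|² = k_l² + |k'|²` with `k'` the transverse coordinates. [folklore] -/
theorem knorm_sq_eq_removeNth (l : Fin (n + 1)) (k : Fin (n + 1) → ℝ) :
    knorm k ^ 2 = k l ^ 2 + knorm (l.removeNth k) ^ 2 := by
  conv_lhs => rw [← Fin.insertNth_self_removeNth l k]
  exact knorm_insertNth_sq l (k l) (l.removeNth k)

/-- `|k'| ≤ |k|`. [folklore] -/
theorem knorm_removeNth_le (l : Fin (n + 1)) (k : Fin (n + 1) → ℝ) :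
    knorm (l.removeNth k) ≤ knorm k := by
  have h := knorm_sq_eq_removeNth l k
  nlinarith [knorm_nonneg k, knorm_nonneg (l.removeNth k), sq_nonneg (k l)]

/-- The shift does not change the transverse coordinates. [folklore] -/
theorem removeNth_shift (l : Fin (n + 1)) (h : ℝ) (k : Fin (n + 1) → ℝ) :
    l.removeNth (shift l h k) = l.removeNth k := by
  simp [shift, Fin.removeNth_update]

/-- The shifted coordinate. [folklore] -/
theorem shift_apply_same (l : Fin (n + 1)) (h : ℝ) (k : Fin (n + 1) → ℝ) : shift l h k l = k l + h := by
  simp [shift]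

/-- The other coordinates. [folklore] -/
theorem shift_apply_of_ne (l : Fin (n + 1)) (h : ℝ) (k : Fin (n + 1) → ℝ) {j : Fin (n + 1)} (hj : j ≠ l) :
    shift l h k j = k j := by
  simp [shift, Function.update_of_ne hj]

/-- `|k + h e_l|² = k_l'² + |k'|²` with `k_l' = k_l + h`. [folklore] -/
theorem knorm_shift_sq (l : Fin (n + 1)) (h : ℝ) (k : Fin (n + 1) → ℝ) :
    knorm (shift l h k) ^ 2 = (k l + h) ^ 2 + knorm (l.removeNth k) ^ 2 := by
  rw [knorm_sq_eq_removeNth l, shift_apply_same, removeNth_shift]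

/-- `|k + h e_l| ≤ |k| + |h|`. [folklore] -/
theorem knorm_shift_le (l : Fin (n + 1)) (h : ℝ) (k : Fin (n + 1) → ℝ) :
    knorm (shift l h k) ≤ knorm k + |h| := by
  have h1 := knorm_shift_sq l h k
  have h2 := knorm_sq_eq_removeNth l k
  have h3 : |k l| ≤ knorm k := abs_apply_le_knorm k l
  have h4 : h * k l ≤ |h| * knorm k := by
    calc h * k l ≤ |h * k l| := le_abs_self _
      _ = |h| * |k l| := abs_mul _ _
      _ ≤ |h| * knorm k := mul_le_mul_of_nonneg_left h3 (abs_nonneg _)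
  have h0 : 0 ≤ knorm k + |h| := add_nonneg (knorm_nonneg _) (abs_nonneg _)
  refine (pow_le_pow_iff_left₀ (knorm_nonneg _) h0 two_ne_zero).1 ?_
  nlinarith [sq_abs h]

/-- `|k'| ≤ |k + h e_l|`. [folklore] -/
theorem knorm_removeNth_le_shift (l : Fin (n + 1)) (h : ℝ) (k : Fin (n + 1) → ℝ) :
    knorm (l.removeNth k) ≤ knorm (shift l h k) := by
  rw [← removeNth_shift l h k]; exact knorm_removeNth_le l _

/-- A point with nonzero transverse part is nonzero, and so are its shifts. [folklore] -/
theorem shift_ne_zero (l : Fin (n + 1)) (h : ℝ) {k : Fin (n + 1) → ℝ} (hk : l.removeNth k ≠ 0) :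
    shift l h k ≠ 0 := by
  intro h0
  apply hk
  rw [← removeNth_shift l h k, h0]
  rfl

/-- Near the origin shifts by `|h| ≤ π/4`-small steps stay in the cube: if `k ∈ [-π,π]^d`,
`|k| < 3h` and `|t| ≤ h ≤ π/4` then `k + t e_l ∈ [-π,π]^d`. [folklore] -/
theorem shift_mem_cube (l : Fin (n + 1)) {h t : ℝ} (hh : h ≤ Real.pi / 4) (ht : |t| ≤ h)
    {k : Fin (n + 1) → ℝ} (hk : k ∈ cube (n + 1)) (hk3 : knorm k < 3 * h) :
    shift l t k ∈ cube (n + 1) := by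
  simp only [cube, Set.mem_pi, Set.mem_univ, true_implies, Set.mem_Icc] at hk ⊢
  intro j
  rcases eq_or_ne j l with rfl | hj
  · rw [shift_apply_same]
    have h1 : |k j| ≤ knorm k := abs_apply_le_knorm k j
    have h2 := abs_le.1 (h1.trans hk3.le)
    have h3 := abs_le.1 ht
    constructor <;> nlinarith [Real.pi_pos]
  · rw [shift_apply_of_ne l t k hj]; exact hk j

/-! ### One-dimensional estimates along a slice -/

section OneDim

variable {φ : ℝ → ℂ} {ρ C e : ℝ}

/-- Reduction into a period: for `s ∈ [-π,π]`, `|t| ≤ h ≤ π` there is `s' ∈ [-π,π]` with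
`s + t - s' ∈ {0, ±2π}` and `|s'| ≥ |s| - h`. [folklore] -/
theorem exists_reduce (s t h : ℝ) (hs : s ∈ Set.Icc (-Real.pi) Real.pi) (ht : |t| ≤ h) (hh : h ≤ Real.pi) :
    ∃ s' ∈ Set.Icc (-Real.pi) Real.pi, (s' = s + t ∨ s' = s + t - 2 * Real.pi ∨ s' = s + t + 2 * Real.pi) ∧
      |s| - h ≤ |s'| := by
  obtain ⟨ht1, ht2⟩ := abs_le.1 ht
  obtain ⟨hs1, hs2⟩ := hs
  have hπ := Real.pi_pos
  have hsabs : |s| ≤ Real.pi := abs_le.2 ⟨hs1, hs2⟩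
  rcases le_or_gt (s + t) Real.pi with h1 | h1
  · rcases le_or_gt (-Real.pi) (s + t) with h2 | h2
    · refine ⟨s + t, ⟨h2, h1⟩, Or.inl rfl, ?_⟩
      rcases le_or_gt 0 s with h0 | h0
      · rw [abs_of_nonneg h0]; have := le_abs_self (s + t); linarith
      · rw [abs_of_neg h0]; have := neg_abs_le (s + t); linarith
    · refine ⟨s + t + 2 * Real.pi, ⟨by linarith, by linarith⟩, Or.inr (Or.inr rfl), ?_⟩
      rw [abs_of_nonneg (by linarith : 0 ≤ s + t + 2 * Real.pi)]
      linarith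
  · refine ⟨s + t - 2 * Real.pi, ⟨by linarith, by linarith⟩, Or.inr (Or.inl rfl), ?_⟩
    rw [abs_of_nonpos (by linarith : s + t - 2 * Real.pi ≤ 0)]
    linarith

/-- The algebra of region II: if `9h² ≤ s² + ρ²` and `|s| - h ≤ |s'|` then
`s² + ρ² ≤ 4 (s'² + ρ²)`. [folklore] -/
theorem sq_add_sq_le_four_mul {s s' ρ h : ℝ} (hII : 9 * h ^ 2 ≤ s ^ 2 + ρ ^ 2)
    (hs' : |s| - h ≤ |s'|) : s ^ 2 + ρ ^ 2 ≤ 4 * (s' ^ 2 + ρ ^ 2) := by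
  rcases le_or_gt (2 * h) |s| with h1 | h1
  · -- `|s'| ≥ |s| - h ≥ |s|/2`
    have h2 : |s| / 2 ≤ |s'| := by linarith
    have h3 : (|s| / 2) ^ 2 ≤ |s'| ^ 2 := pow_le_pow_left₀ (by positivity) h2 2
    rw [sq_abs] at h3
    nlinarith [sq_abs s, sq_nonneg s']
  · -- `s² < 4h²`, so `ρ² ≥ 5h² ≥ s²`
    have h2 : s ^ 2 < 4 * h ^ 2 := by
      have := abs_nonneg s
      nlinarith [sq_abs s]
    nlinarith [sq_nonneg s']

/-- **The supremum over a short window.** Let `g : ℝ → ℂ` be `2π`-periodic with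
`‖g(s')‖ ≤ C / √(s'² + ρ²)^e` on `[-π,π]` (`C, e ≥ 0`, `ρ > 0`). Then for `s ∈ [-π,π]`, `|t| ≤ h ≤ π`
and `9h² ≤ s² + ρ²`: `‖g(s + t)‖ ≤ 2^e C / √(s² + ρ²)^e`. [folklore] -/
theorem norm_le_of_window {g : ℝ → ℂ} (hper : Function.Periodic g (2 * Real.pi)) (hρ : 0 < ρ)
    (hC : 0 ≤ C) (he : 0 ≤ e)
    (hb : ∀ s' ∈ Set.Icc (-Real.pi) Real.pi, ‖g s'‖ ≤ C / Real.sqrt (s' ^ 2 + ρ ^ 2) ^ e)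
    {s t h : ℝ} (hs : s ∈ Set.Icc (-Real.pi) Real.pi) (ht : |t| ≤ h) (hh : h ≤ Real.pi)
    (hII : 9 * h ^ 2 ≤ s ^ 2 + ρ ^ 2) :
    ‖g (s + t)‖ ≤ (2 : ℝ) ^ e * C / Real.sqrt (s ^ 2 + ρ ^ 2) ^ e := by
  obtain ⟨s', hs'mem, hs'eq, hs'abs⟩ := exists_reduce s t h hs ht hh
  have hgs : g (s + t) = g s' := by
    rcases hs'eq with h1 | h1 | h1
    · rw [h1]
    · rw [h1, hper.sub_eq]
    · rw [h1, hper]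
  rw [hgs]
  refine (hb s' hs'mem).trans ?_
  have h4 := sq_add_sq_le_four_mul hII hs'abs
  have hpos : 0 < s ^ 2 + ρ ^ 2 := by positivity
  have hpos' : 0 < s' ^ 2 + ρ ^ 2 := by positivity
  -- `√(s²+ρ²)/2 ≤ √(s'²+ρ²)`
  have hsqrt : Real.sqrt (s ^ 2 + ρ ^ 2) / 2 ≤ Real.sqrt (s' ^ 2 + ρ ^ 2) := by
    rw [div_le_iff₀ two_pos, show Real.sqrt (s' ^ 2 + ρ ^ 2) * 2 = Real.sqrt (4 * (s' ^ 2 + ρ ^ 2)) by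
      rw [Real.sqrt_mul' _ hpos'.le, show Real.sqrt 4 = 2 by
        rw [show (4 : ℝ) = 2 ^ 2 by norm_num, Real.sqrt_sq two_pos.le]]; ring]
    exact Real.sqrt_le_sqrt h4
  have hq : 0 < Real.sqrt (s ^ 2 + ρ ^ 2) / 2 := div_pos (Real.sqrt_pos.2 hpos) two_pos
  calc C / Real.sqrt (s' ^ 2 + ρ ^ 2) ^ e ≤ C / (Real.sqrt (s ^ 2 + ρ ^ 2) / 2) ^ e := by
        refine div_le_div_of_nonneg_left hC (Real.rpow_pos_of_pos hq e) ?_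
        exact Real.rpow_le_rpow hq.le hsqrt he
    _ = (2 : ℝ) ^ e * C / Real.sqrt (s ^ 2 + ρ ^ 2) ^ e := by
        rw [Real.div_rpow (Real.sqrt_nonneg _) two_pos.le]
        field_simp

/-- **Second difference, first-order version**: for `φ : ℝ → ℂ` of class `C¹` with
`‖φ'(u)‖ ≤ M` on `[s - h, s + h]`, `‖φ(s) - ½(φ(s+h) + φ(s-h))‖ ≤ h M`. [folklore] -/
theorem norm_sdiff_le_of_deriv {φ : ℝ → ℂ} (hφ : Differentiable ℝ φ) {s h M : ℝ} (h0 : 0 ≤ h)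
    (hM : ∀ u ∈ Set.Icc (s - h) (s + h), ‖deriv φ u‖ ≤ M) :
    ‖φ s - (φ (s + h) + φ (s - h)) / 2‖ ≤ h * M := by
  have hconv : Convex ℝ (Set.Icc (s - h) (s + h)) := convex_Icc _ _
  have hsmem : s ∈ Set.Icc (s - h) (s + h) := ⟨by linarith, by linarith⟩
  have h1 : ‖φ (s + h) - φ s‖ ≤ M * ‖s + h - s‖ :=
    hconv.norm_image_sub_le_of_norm_deriv_le (fun u _ => hφ u) hM hsmem ⟨by linarith, le_rfl⟩
  have h2 : ‖φ (s - h) - φ s‖ ≤ M * ‖s - h - s‖ :=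
    hconv.norm_image_sub_le_of_norm_deriv_le (fun u _ => hφ u) hM hsmem ⟨le_rfl, by linarith⟩
  rw [show s + h - s = h by ring, Real.norm_of_nonneg h0] at h1
  rw [show s - h - s = -h by ring, norm_neg, Real.norm_of_nonneg h0] at h2
  have h3 : φ s - (φ (s + h) + φ (s - h)) / 2 = -((φ (s + h) - φ s) + (φ (s - h) - φ s)) / 2 := by ring
  rw [h3, norm_div, norm_neg, Complex.norm_two]
  have := norm_add_le (φ (s + h) - φ s) (φ (s - h) - φ s)
  linarith

/-- **Second difference, second-order version**: for `φ : ℝ → ℂ` of class `C²` with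
`‖φ''(u)‖ ≤ M` on `[s - h, s + h]`, `‖φ(s) - ½(φ(s+h) + φ(s-h))‖ ≤ h² M`
(`ψ(t) = φ(s+t) + φ(s-t)` has `‖ψ'(t)‖ ≤ 2tM`). [folklore] -/
theorem norm_sdiff_le_of_deriv_two {φ : ℝ → ℂ} (hφ : ContDiff ℝ 2 φ) {s h M : ℝ} (h0 : 0 ≤ h)
    (hM : ∀ u ∈ Set.Icc (s - h) (s + h), ‖iteratedDeriv 2 φ u‖ ≤ M) :
    ‖φ s - (φ (s + h) + φ (s - h)) / 2‖ ≤ h ^ 2 * M := by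
  have hd1 : Differentiable ℝ φ := hφ.differentiable (by norm_num)
  have hd2 : Differentiable ℝ (deriv φ) := by
    have := hφ.differentiable_iteratedDeriv 1 (by norm_num)
    rwa [iteratedDeriv_one] at this
  have hM' : ∀ u ∈ Set.Icc (s - h) (s + h), ‖deriv (deriv φ) u‖ ≤ M := by
    intro u hu
    have := hM u hu
    rwa [iteratedDeriv_succ, iteratedDeriv_one] at this
  have hMnn : 0 ≤ M := le_trans (norm_nonneg _) (hM s ⟨by linarith, by linarith⟩)
  -- `ψ(t) = φ(s+t) + φ(s-t)` and its derivative
  set ψ : ℝ → ℂ := fun t => φ (s + t) + φ (s - t) with hψ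
  have hψd : ∀ t, HasDerivAt ψ (deriv φ (s + t) - deriv φ (s - t)) t := by
    intro t
    have h1 : HasDerivAt (fun t => φ (s + t)) (deriv φ (s + t)) t := by
      simpa using ((hd1 (s + t)).hasDerivAt).comp_const_add s t
    have h2 : HasDerivAt (fun t => φ (s - t)) (-deriv φ (s - t)) t := by
      simpa using ((hd1 (s - t)).hasDerivAt).comp_const_sub s t
    simpa [hψ, sub_eq_add_neg] using h1.fun_add h2
  -- `‖ψ'(t)‖ ≤ 2hM` on `[0,h]`
  have hψ' : ∀ t ∈ Set.Icc (0 : ℝ) h, ‖deriv ψ t‖ ≤ 2 * h * M := by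
    intro t ht
    rw [(hψd t).deriv]
    have hconv : Convex ℝ (Set.Icc (s - h) (s + h)) := convex_Icc _ _
    have hb := hconv.norm_image_sub_le_of_norm_deriv_le (fun u _ => hd2 u) hM'
      (⟨by linarith [ht.1, ht.2], by linarith [ht.1, ht.2]⟩ : s - t ∈ Set.Icc (s - h) (s + h))
      (⟨by linarith [ht.1, ht.2], by linarith [ht.1, ht.2]⟩ : s + t ∈ Set.Icc (s - h) (s + h))
    rw [show s + t - (s - t) = 2 * t by ring, Real.norm_of_nonneg (by linarith [ht.1])] at hb
    calc ‖deriv φ (s + t) - deriv φ (s - t)‖ ≤ M * (2 * t) := hb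
      _ ≤ 2 * h * M := by nlinarith [ht.2]
  -- `‖ψ(h) - ψ(0)‖ ≤ 2hM · h`
  have hψdiff : Differentiable ℝ ψ := fun t => (hψd t).differentiableAt
  have hb := (convex_Icc (0 : ℝ) h).norm_image_sub_le_of_norm_deriv_le (fun u _ => hψdiff u) hψ'
    (⟨le_rfl, h0⟩ : (0 : ℝ) ∈ Set.Icc 0 h) (⟨h0, le_rfl⟩ : h ∈ Set.Icc 0 h)
  rw [sub_zero, Real.norm_of_nonneg h0] at hb
  have hψ0 : ψ 0 = 2 * φ s := by simp [hψ]; ring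
  have h3 : φ s - (φ (s + h) + φ (s - h)) / 2 = -(ψ h - ψ 0) / 2 := by
    rw [hψ0]; simp only [hψ]; ring
  rw [h3, norm_div, norm_neg, Complex.norm_two]
  nlinarith

end OneDim

/-! ### Slice bounds of Hara's type and the two pointwise regimes -/

variable {F : (Fin (n + 1) → ℝ) → ℂ} {l : Fin (n + 1)} {a C : ℝ} {r : ℕ}

/-- **Slice bounds of Hara's type** for `F` along the coordinate `l`, with decay exponent `a`,
smoothness order `r` and constant `C`: `F` is `2π`-periodic in `k_l`; for every transverse momentum
`k' ∈ [-π,π]^n ∖ {0}` the slice `s ↦ F(ins_l(s,k'))` is `C^r`; `|F(k)| ≤ C/|k|^a` on the punctured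
cube; and `|∂_s^r F(ins_l(s,k'))| ≤ C/|k|^{a+r}`. (For `F = ∂_l^m Ĝ` these are Hara's Lemma 4.1 with
`a = 2 + m` and the slice regularity of `Ĝ = ĝ/(1-Ĵ)`.) [cite: Hara2008, Lemma 4.1 and §4.1.2] -/
structure SliceBound (F : (Fin (n + 1) → ℝ) → ℂ) (l : Fin (n + 1)) (a : ℝ) (r : ℕ) (C : ℝ) : Prop where
  periodic : IsPeriodicIn l F
  contDiff : ∀ k' ∈ cube n, k' ≠ 0 → ContDiff ℝ r (fun s : ℝ => F (l.insertNth s k'))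
  norm_le : ∀ k ∈ cube (n + 1), k ≠ 0 → ‖F k‖ ≤ C / knorm k ^ a
  norm_iteratedDeriv_le : ∀ k' ∈ cube n, k' ≠ 0 → ∀ s ∈ Set.Icc (-Real.pi) Real.pi,
    ‖iteratedDeriv r (fun s : ℝ => F (l.insertNth s k')) s‖ ≤
      C / knorm (l.insertNth s k' : Fin (n + 1) → ℝ) ^ (a + r)


/-- Slice bounds are stable under multiplication by a constant of norm at most one. [folklore] -/
theorem SliceBound.const_mul (hF : SliceBound F l a r C) {c : ℂ} (hc : ‖c‖ ≤ 1) :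
    SliceBound (fun k => c * F k) l a r C where
  periodic := fun k => by simp only [hF.periodic k]
  contDiff := fun k' hk' hk'0 => contDiff_const.mul (hF.contDiff k' hk' hk'0)
  norm_le := fun k hk hk0 => by
    rw [norm_mul]
    calc ‖c‖ * ‖F k‖ ≤ 1 * ‖F k‖ := mul_le_mul_of_nonneg_right hc (norm_nonneg _)
      _ = ‖F k‖ := one_mul _
      _ ≤ C / knorm k ^ a := hF.norm_le k hk hk0
  norm_iteratedDeriv_le := fun k' hk' hk'0 s hs => by
    have h := hF.norm_iteratedDeriv_le k' hk' hk'0 s hs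
    have hcd : ContDiffAt ℝ r (fun s : ℝ => F (l.insertNth s k')) s := (hF.contDiff k' hk' hk'0).contDiffAt
    rw [iteratedDeriv_const_mul c hcd, norm_mul]
    calc ‖c‖ * ‖iteratedDeriv r (fun s : ℝ => F (l.insertNth s k')) s‖
        ≤ 1 * ‖iteratedDeriv r (fun s : ℝ => F (l.insertNth s k')) s‖ :=
          mul_le_mul_of_nonneg_right hc (norm_nonneg _)
      _ ≤ C / knorm (l.insertNth s k' : Fin (n + 1) → ℝ) ^ (a + r) := by rw [one_mul]; exact h

/-- `|ins_l(s,k')| = √(s² + |k'|²)`. [folklore] -/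
theorem knorm_insertNth_eq_sqrt (l : Fin (n + 1)) (s : ℝ) (k' : Fin n → ℝ) :
    knorm (l.insertNth s k' : Fin (n + 1) → ℝ) = Real.sqrt (s ^ 2 + knorm k' ^ 2) := by
  rw [← knorm_insertNth_sq l s k', Real.sqrt_sq (knorm_nonneg _)]

/-- A point of the cube with nonzero transverse part: its slice data. [folklore] -/
theorem slice_data {k : Fin (n + 1) → ℝ} (hk : k ∈ cube (n + 1)) (l : Fin (n + 1)) :
    k l ∈ Set.Icc (-Real.pi) Real.pi ∧ l.removeNth k ∈ cube n ∧
      k = l.insertNth (k l) (l.removeNth k) := by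
  have hk' := hk
  rw [← Fin.insertNth_self_removeNth l k, insertNth_mem_cube_iff] at hk'
  exact ⟨hk'.1, hk'.2, (Fin.insertNth_self_removeNth l k).symm⟩

/-- **Region II** (`|k| ≥ 3h`): `|Δ²_h F(k)| ≤ h^r 2^{a+r} C / |k|^{a+r}` (mean value along the slice,
the window supremum of `∂_s^r F` controlled through periodicity). [folklore] -/
theorem norm_sdiff_le_far (hF : SliceBound F l a r C) (hr : r = 1 ∨ r = 2) (ha : 0 ≤ a) (hC : 0 ≤ C)
    {h : ℝ} (h0 : 0 < h) (hh : h ≤ Real.pi) {k : Fin (n + 1) → ℝ} (hk : k ∈ cube (n + 1))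
    (hk' : l.removeNth k ≠ 0) (hII : 3 * h ≤ knorm k) :
    ‖sdiff F l h k‖ ≤ h ^ r * ((2 : ℝ) ^ (a + r) * C / knorm k ^ (a + r)) := by
  obtain ⟨hs, hk'c, hkeq⟩ := slice_data hk l
  set s := k l with hs_def
  set k' := l.removeNth k with hk'_def
  set ρ := knorm k' with hρ_def
  have hρ : 0 < ρ := knorm_pos_of_ne_zero hk'
  set φ : ℝ → ℂ := fun u => F (l.insertNth u k') with hφ_def
  -- the second difference along the slice
  have hsd : sdiff F l h k = φ s - (φ (s + h) + φ (s - h)) / 2 := by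
    simp only [sdiff, hφ_def]
    rw [hkeq, shift_insertNth, shift_insertNth, ← sub_eq_add_neg]
  have hknorm : knorm k = Real.sqrt (s ^ 2 + ρ ^ 2) := by rw [hkeq, knorm_insertNth_eq_sqrt]
  have hII' : 9 * h ^ 2 ≤ s ^ 2 + ρ ^ 2 := by
    have h1 : (3 * h) ^ 2 ≤ knorm k ^ 2 := pow_le_pow_left₀ (by linarith) hII 2
    rw [hknorm, Real.sq_sqrt (by positivity)] at h1
    linarith
  -- the window bound on `∂_s^r φ`
  set g : ℝ → ℂ := iteratedDeriv r φ with hg_def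
  have hgper : Function.Periodic g (2 * Real.pi) := iteratedDeriv_periodic (hF.periodic.slice k') r
  have hgb : ∀ s' ∈ Set.Icc (-Real.pi) Real.pi, ‖g s'‖ ≤ C / Real.sqrt (s' ^ 2 + ρ ^ 2) ^ (a + r) := by
    intro s' hs'
    have := hF.norm_iteratedDeriv_le k' hk'c hk' s' hs'
    rwa [knorm_insertNth_eq_sqrt] at this
  set M : ℝ := (2 : ℝ) ^ (a + r) * C / Real.sqrt (s ^ 2 + ρ ^ 2) ^ (a + r) with hM_def
  have hwin : ∀ u ∈ Set.Icc (s - h) (s + h), ‖g u‖ ≤ M := by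
    intro u hu
    have ht : |u - s| ≤ h := abs_le.2 ⟨by linarith [hu.1], by linarith [hu.2]⟩
    have := norm_le_of_window hgper hρ hC (by positivity) hgb hs ht hh hII'
    rwa [show s + (u - s) = u by ring] at this
  rw [hsd, hknorm]
  have hcd : ContDiff ℝ r φ := hF.contDiff k' hk'c hk'
  rcases hr with rfl | rfl
  · -- first order
    have hd : Differentiable ℝ φ := hcd.differentiable (by norm_num)
    have hwin' : ∀ u ∈ Set.Icc (s - h) (s + h), ‖deriv φ u‖ ≤ M := by
      intro u hu; have := hwin u hu; rwa [hg_def, iteratedDeriv_one] at this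
    have := norm_sdiff_le_of_deriv hd h0.le hwin'
    simpa [hM_def] using this
  · -- second order
    have hcd2 : ContDiff ℝ 2 φ := by simpa using hcd
    have := norm_sdiff_le_of_deriv_two hcd2 h0.le hwin
    simpa [hM_def] using this

/-- **Region I** (`|k| < 3h`, `h ≤ π/4`): the three values are bounded separately,
`|Δ²_h F(k)| ≤ C/|k|^a + ½(C/|k + he_l|^a + C/|k - he_l|^a)`. [folklore] -/
theorem norm_sdiff_le_near (hF : SliceBound F l a r C) {h : ℝ} (h0 : 0 < h) (hh : h ≤ Real.pi / 4)
    {k : Fin (n + 1) → ℝ} (hk : k ∈ cube (n + 1)) (hk' : l.removeNth k ≠ 0) (hI : knorm k < 3 * h) :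
    ‖sdiff F l h k‖ ≤ C / knorm k ^ a + (C / knorm (shift l h k) ^ a + C / knorm (shift l (-h) k) ^ a) / 2 := by
  have hk0 : k ≠ 0 := by
    intro h0'; apply hk'; rw [h0']; rfl
  have h1 := hF.norm_le k hk hk0
  have habs : |h| ≤ h := (abs_of_pos h0).le
  have habs' : |-h| ≤ h := by rw [abs_neg]; exact habs
  have h2 := hF.norm_le _ (shift_mem_cube l hh habs hk hI) (shift_ne_zero l h hk')
  have h3 := hF.norm_le _ (shift_mem_cube l hh habs' hk hI) (shift_ne_zero l (-h) hk')
  rw [sdiff]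
  refine (norm_sub_le _ _).trans (add_le_add h1 ?_)
  rw [norm_div, Complex.norm_two]
  exact div_le_div_of_nonneg_right ((norm_add_le _ _).trans (add_le_add h2 h3)) two_pos.le

/-! ### Power-counting inequalities -/

/-- For `0 ≤ u < R` and `0 < e₁ ≤ e₂`: `u^{-e₁} ≤ R^{e₂ - e₁} u^{-e₂}`. [folklore] -/
theorem rpow_neg_le_near {u R e₁ e₂ : ℝ} (hu : 0 ≤ u) (huR : u < R) (he₁ : 0 < e₁) (he : e₁ ≤ e₂) :
    u ^ (-e₁) ≤ R ^ (e₂ - e₁) * u ^ (-e₂) := by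
  rcases hu.eq_or_lt with h0 | hu'
  · rw [← h0, Real.zero_rpow (by linarith), Real.zero_rpow (by linarith), mul_zero]
  · rw [show -e₁ = (e₂ - e₁) + -e₂ by ring, Real.rpow_add hu']
    exact mul_le_mul_of_nonneg_right (Real.rpow_le_rpow hu huR.le (by linarith))
      (Real.rpow_nonneg hu _)

/-- For `0 < R ≤ u` and `e₂ ≤ e₁`: `u^{-e₁} ≤ R^{e₂ - e₁} u^{-e₂}`. [folklore] -/
theorem rpow_neg_le_far {u R e₁ e₂ : ℝ} (hR : 0 < R) (huR : R ≤ u) (he : e₂ ≤ e₁) :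
    u ^ (-e₁) ≤ R ^ (e₂ - e₁) * u ^ (-e₂) := by
  have hu : 0 < u := lt_of_lt_of_le hR huR
  rw [show -e₁ = (e₂ - e₁) + -e₂ by ring, Real.rpow_add hu]
  exact mul_le_mul_of_nonneg_right (Real.rpow_le_rpow_of_nonpos hR huR (by linarith))
    (Real.rpow_nonneg hu.le _)

/-- `(x + y + z)^p ≤ 3^p (x^p + y^p + z^p)` for `x, y, z, p ≥ 0`. [folklore] -/
theorem add_three_rpow_le {x y z p : ℝ} (hx : 0 ≤ x) (hy : 0 ≤ y) (hz : 0 ≤ z) (hp : 0 ≤ p) :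
    (x + y + z) ^ p ≤ (3 : ℝ) ^ p * (x ^ p + y ^ p + z ^ p) := by
  set m := max x (max y z) with hm
  have hxm : x ≤ m := le_max_left _ _
  have hym : y ≤ m := (le_max_left _ _).trans (le_max_right _ _)
  have hzm : z ≤ m := (le_max_right _ _).trans (le_max_right _ _)
  have hm0 : 0 ≤ m := hx.trans hxm
  have h1 : (x + y + z) ^ p ≤ (3 * m) ^ p := Real.rpow_le_rpow (by positivity) (by linarith) hp
  have h2 : m ^ p ≤ x ^ p + y ^ p + z ^ p := by
    have hxp := Real.rpow_nonneg hx p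
    have hyp := Real.rpow_nonneg hy p
    have hzp := Real.rpow_nonneg hz p
    rcases le_total y z with hyz | hyz
    · rcases le_total x (max y z) with hxyz | hxyz
      · rw [hm, max_eq_right hxyz, max_eq_right hyz]; linarith
      · rw [hm, max_eq_left hxyz]; linarith
    · rcases le_total x (max y z) with hxyz | hxyz
      · rw [hm, max_eq_right hxyz, max_eq_left hyz]; linarith
      · rw [hm, max_eq_left hxyz]; linarith
  calc (x + y + z) ^ p ≤ (3 * m) ^ p := h1
    _ = (3 : ℝ) ^ p * m ^ p := Real.mul_rpow (by norm_num) hm0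
    _ ≤ (3 : ℝ) ^ p * (x ^ p + y ^ p + z ^ p) := mul_le_mul_of_nonneg_left h2 (by positivity)

/-- `(C/u^a)^p = C^p u^{-ap}` for `u, C ≥ 0`. [folklore] -/
theorem div_rpow_rpow {C u a p : ℝ} (hC : 0 ≤ C) (hu : 0 ≤ u) :
    (C / u ^ a) ^ p = C ^ p * u ^ (-(a * p)) := by
  rw [Real.div_rpow hC (Real.rpow_nonneg hu a), ← Real.rpow_mul hu, Real.rpow_neg hu, div_eq_mul_inv]

/-! ### Null sets: points of the cube with vanishing transverse part -/

/-- For `n ≥ 1`, almost every `k` (Lebesgue) has nonzero transverse part `k'`. [folklore] -/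
theorem ae_removeNth_ne_zero (hn : 1 ≤ n) (l : Fin (n + 1)) :
    ∀ᵐ k ∂(volume : Measure (Fin (n + 1) → ℝ)), l.removeNth k ≠ 0 := by
  have h := MeasureTheory.Measure.ae_eval_ne (fun _ : Fin (n + 1) => (volume : Measure ℝ))
    (l.succAbove ⟨0, hn⟩) (0 : ℝ)
  rw [← volume_pi] at h
  filter_upwards [h] with k hk
  intro h0
  apply hk
  have := congrFun h0 ⟨0, hn⟩
  simpa [Fin.removeNth] using this

/-! ### The `L^p` bound for one second difference -/

/-- The reference integral `∫_{[-π,π]^d} |k|^{-q} dk` is finite for `0 ≤ q < d`. [folklore] -/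
theorem lintegral_knorm_rpow_neg_lt_top (hd : 1 ≤ n + 1) {q : ℝ} (hq0 : 0 ≤ q) (hq : q < n + 1) :
    ∫⁻ k in cube (n + 1), ENNReal.ofReal (knorm k ^ (-q)) < ⊤ :=
  (integrableOn_knorm_rpow_neg hd hq0 (by exact_mod_cast hq)).lintegral_lt_top

/-- Shifts are translations. [folklore] -/
theorem shift_eq_add (l : Fin (n + 1)) (h : ℝ) (k : Fin (n + 1) → ℝ) :
    shift l h k = k + Function.update (0 : Fin (n + 1) → ℝ) l h := by
  ext i
  rcases eq_or_ne i l with rfl | hi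
  · simp [shift_apply_same]
  · simp [shift_apply_of_ne l h k hi, Function.update_of_ne hi]

/-- A small ball around the origin lies in the cube: `|q| < R ≤ π` implies `q ∈ [-π,π]^d`. [folklore] -/
theorem mem_cube_of_knorm_lt {q : Fin (n + 1) → ℝ} {R : ℝ} (hq : knorm q < R) (hR : R ≤ Real.pi) :
    q ∈ cube (n + 1) := by
  simp only [cube, Set.mem_pi, Set.mem_univ, true_implies, Set.mem_Icc]
  intro i
  have := abs_le.1 (((abs_apply_le_knorm q i).trans hq.le).trans hR)
  exact ⟨this.1, this.2⟩

/-- The shifted near-origin pieces: for `0 < h ≤ π/4`, `|t| ≤ h`, `0 < e₁ ≤ q`,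
`∫_{[-π,π]^d ∩ {|k| < 3h}} |k + te_l|^{-e₁} dk ≤ (4h)^{q-e₁} ∫_{[-π,π]^d} |k|^{-q} dk`
(translation invariance of Lebesgue measure). [folklore] -/
theorem lintegral_near_shift_le (l : Fin (n + 1)) {h t e₁ q : ℝ} (h0 : 0 < h) (hh : h ≤ Real.pi / 4)
    (ht : |t| ≤ h) (he₁ : 0 < e₁) (he : e₁ ≤ q) :
    ∫⁻ k in cube (n + 1) ∩ {k | knorm k < 3 * h}, ENNReal.ofReal (knorm (shift l t k) ^ (-e₁)) ≤
      ENNReal.ofReal ((4 * h) ^ (q - e₁)) * ∫⁻ k in cube (n + 1), ENNReal.ofReal (knorm k ^ (-q)) := by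
  set B : Set (Fin (n + 1) → ℝ) := {q' | knorm q' < 4 * h} with hB
  have hBm : MeasurableSet B := by
    have hc : Continuous (knorm : (Fin (n + 1) → ℝ) → ℝ) := by unfold knorm; fun_prop
    exact measurableSet_lt hc.measurable measurable_const
  set Ψ : (Fin (n + 1) → ℝ) → ℝ≥0∞ :=
    B.indicator fun q' => ENNReal.ofReal ((4 * h) ^ (q - e₁)) * ENNReal.ofReal (knorm q' ^ (-q)) with hΨ
  -- pointwise on the region
  have hpt : ∀ k ∈ cube (n + 1) ∩ {k | knorm k < 3 * h},
      ENNReal.ofReal (knorm (shift l t k) ^ (-e₁)) ≤ Ψ (shift l t k) := by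
    rintro k ⟨-, hk3⟩
    have hk3 : knorm k < 3 * h := hk3
    have hsB : shift l t k ∈ B := by
      show knorm (shift l t k) < 4 * h
      have := knorm_shift_le l t k
      linarith
    rw [hΨ, Set.indicator_of_mem hsB, ← ENNReal.ofReal_mul (Real.rpow_nonneg (by linarith) _)]
    exact ENNReal.ofReal_le_ofReal (rpow_neg_le_near (knorm_nonneg _) hsB he₁ he)
  calc ∫⁻ k in cube (n + 1) ∩ {k | knorm k < 3 * h}, ENNReal.ofReal (knorm (shift l t k) ^ (-e₁))
      ≤ ∫⁻ k in cube (n + 1) ∩ {k | knorm k < 3 * h}, Ψ (shift l t k) :=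
        setLIntegral_mono' ((measurableSet_cube _).inter (measurableSet_lt
          (by unfold knorm; fun_prop : Continuous (knorm : (Fin (n + 1) → ℝ) → ℝ)).measurable
          measurable_const)) hpt
    _ ≤ ∫⁻ k, Ψ (shift l t k) := setLIntegral_le_lintegral _ _
    _ = ∫⁻ k, Ψ k := by
        simp_rw [shift_eq_add l t]
        exact lintegral_add_right_eq_self Ψ _
    _ = ENNReal.ofReal ((4 * h) ^ (q - e₁)) * ∫⁻ k in B, ENNReal.ofReal (knorm k ^ (-q)) := by
        rw [hΨ, lintegral_indicator hBm, lintegral_const_mul']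
        exact ENNReal.ofReal_ne_top
    _ ≤ ENNReal.ofReal ((4 * h) ^ (q - e₁)) * ∫⁻ k in cube (n + 1), ENNReal.ofReal (knorm k ^ (-q)) := by
        refine mul_le_mul' le_rfl (lintegral_mono_set fun q' hq' => ?_)
        exact mem_cube_of_knorm_lt hq' (by linarith)

/-- **The `L^p`-modulus bound.** Under `SliceBound F l a r C` (`r = 1` or `2`, `a > 0`, `n ≥ 1`), for
`p ≥ 1` and any `q` with `ap ≤ q ≤ (a+r)p`, `q < d = n + 1`, there is `K < ∞` such that for all
`0 < h ≤ π/4`:  `∫_{[-π,π]^d} |Δ²_h F(k)|^p dk ≤ K h^{q - ap}`. [folklore] -/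
theorem lintegral_rpow_sdiff_le (hn : 1 ≤ n) (hF : SliceBound F l a r C) (hr : r = 1 ∨ r = 2)
    (ha : 0 < a) (hC : 0 ≤ C) {p : ℝ} (hp : 1 ≤ p) {q : ℝ} (hq1 : a * p ≤ q) (hq2 : q ≤ (a + r) * p)
    (hq3 : q < n + 1) :
    ∃ K : ℝ≥0∞, K ≠ ⊤ ∧ ∀ h : ℝ, 0 < h → h ≤ Real.pi / 4 →
      ∫⁻ k in cube (n + 1), ‖sdiff F l h k‖ₑ ^ p ≤ K * ENNReal.ofReal (h ^ (q - a * p)) := by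
  have hp0 : 0 < p := by linarith
  have hap : 0 < a * p := mul_pos ha hp0
  have hr0 : (0 : ℝ) < r := by rcases hr with rfl | rfl <;> norm_num
  set L := ∫⁻ k in cube (n + 1), ENNReal.ofReal (knorm k ^ (-q)) with hL
  have hLt : L < ⊤ := lintegral_knorm_rpow_neg_lt_top (by omega) (by nlinarith) hq3
  -- the constants
  set c₁ : ℝ≥0∞ := ENNReal.ofReal ((3 : ℝ) ^ p * C ^ p) with hc₁
  set c₂ : ℝ≥0∞ := ENNReal.ofReal (((2 : ℝ) ^ (a + r) * C) ^ p * (3 : ℝ) ^ (q - (a + r) * p)) with hc₂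
  set K : ℝ≥0∞ := c₁ * (ENNReal.ofReal ((3 : ℝ) ^ (q - a * p)) + 2 * ENNReal.ofReal ((4 : ℝ) ^ (q - a * p))) * L
    + c₂ * L with hK
  refine ⟨K, ?_, fun h h0 hh => ?_⟩
  · rw [hK]
    have hL' : L ≠ ⊤ := hLt.ne
    apply_rules [ENNReal.add_ne_top.2, And.intro, ENNReal.mul_ne_top, ENNReal.ofReal_ne_top,
      ENNReal.mul_ne_top, ENNReal.ofNat_ne_top]
  have hhπ : h ≤ Real.pi := hh.trans (by linarith [Real.pi_pos])
  -- the two regions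
  set I : Set (Fin (n + 1) → ℝ) := {k | knorm k < 3 * h} with hI
  have hkc : Continuous (knorm : (Fin (n + 1) → ℝ) → ℝ) := by unfold knorm; fun_prop
  have hIm : MeasurableSet I := measurableSet_lt hkc.measurable measurable_const
  -- the explicit majorant
  set ψ : ℝ → (Fin (n + 1) → ℝ) → ℝ≥0∞ := fun t k => ENNReal.ofReal (knorm (shift l t k) ^ (-(a * p))) with hψ
  set A : (Fin (n + 1) → ℝ) → ℝ≥0∞ := I.indicator fun k => c₁ * (ψ 0 k + ψ h k + ψ (-h) k) with hA
  set Bf : (Fin (n + 1) → ℝ) → ℝ≥0∞ := Iᶜ.indicator fun k =>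
    ENNReal.ofReal (((2 : ℝ) ^ (a + r) * C) ^ p * h ^ (r * p)) * ENNReal.ofReal (knorm k ^ (-((a + r) * p))) with hBf
  -- pointwise a.e. on the cube
  have hpt : ∀ᵐ k ∂(volume : Measure (Fin (n + 1) → ℝ)).restrict (cube (n + 1)),
      ‖sdiff F l h k‖ₑ ^ p ≤ A k + Bf k := by
    filter_upwards [ae_restrict_mem (measurableSet_cube _),
      ae_restrict_of_ae (ae_removeNth_ne_zero hn l)] with k hk hk'
    rw [← ofReal_norm, ENNReal.ofReal_rpow_of_nonneg (norm_nonneg _) hp0.le]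
    by_cases hkI : k ∈ I
    · -- region I
      have hkI' : knorm k < 3 * h := hkI
      rw [hA, hBf, Set.indicator_of_mem hkI, Set.indicator_of_notMem (Set.notMem_compl_iff.2 hkI), add_zero]
      have hb := norm_sdiff_le_near hF h0 hh hk hk' hkI'
      set x := C / knorm k ^ a
      set y := C / knorm (shift l h k) ^ a
      set z := C / knorm (shift l (-h) k) ^ a
      have hx : 0 ≤ x := div_nonneg hC (Real.rpow_nonneg (knorm_nonneg _) _)
      have hy : 0 ≤ y := div_nonneg hC (Real.rpow_nonneg (knorm_nonneg _) _)
      have hz : 0 ≤ z := div_nonneg hC (Real.rpow_nonneg (knorm_nonneg _) _)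
      have hb' : ‖sdiff F l h k‖ ≤ x + y + z := by linarith
      have h3 := add_three_rpow_le hx hy hz hp0.le
      have hxp : x ^ p = C ^ p * knorm (shift l 0 k) ^ (-(a * p)) := by
        rw [shift_zero]; exact div_rpow_rpow hC (knorm_nonneg _)
      have hyp : y ^ p = C ^ p * knorm (shift l h k) ^ (-(a * p)) := div_rpow_rpow hC (knorm_nonneg _)
      have hzp : z ^ p = C ^ p * knorm (shift l (-h) k) ^ (-(a * p)) := div_rpow_rpow hC (knorm_nonneg _)
      calc ENNReal.ofReal (‖sdiff F l h k‖ ^ p) ≤ ENNReal.ofReal ((x + y + z) ^ p) :=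
            ENNReal.ofReal_le_ofReal (Real.rpow_le_rpow (norm_nonneg _) hb' hp0.le)
        _ ≤ ENNReal.ofReal ((3 : ℝ) ^ p * (x ^ p + y ^ p + z ^ p)) := ENNReal.ofReal_le_ofReal h3
        _ = c₁ * (ψ 0 k + ψ h k + ψ (-h) k) := by
            rw [hxp, hyp, hzp, hc₁, hψ]
            simp only []
            rw [← ENNReal.ofReal_add (Real.rpow_nonneg (knorm_nonneg _) _) (Real.rpow_nonneg (knorm_nonneg _) _),
              ← ENNReal.ofReal_add (add_nonneg (Real.rpow_nonneg (knorm_nonneg _) _)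
                (Real.rpow_nonneg (knorm_nonneg _) _)) (Real.rpow_nonneg (knorm_nonneg _) _),
              ← ENNReal.ofReal_mul (by positivity)]
            congr 1
            ring
    · -- region II
      have hkII : 3 * h ≤ knorm k := not_lt.1 hkI
      rw [hA, hBf, Set.indicator_of_notMem hkI, Set.indicator_of_mem (Set.mem_compl hkI), zero_add]
      have hb := norm_sdiff_le_far hF hr ha.le hC h0 hhπ hk hk' hkII
      have hknn : 0 ≤ knorm k := knorm_nonneg k
      have hrhs : 0 ≤ h ^ r * ((2 : ℝ) ^ (a + r) * C / knorm k ^ (a + r)) := by positivity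
      calc ENNReal.ofReal (‖sdiff F l h k‖ ^ p)
          ≤ ENNReal.ofReal ((h ^ r * ((2 : ℝ) ^ (a + r) * C / knorm k ^ (a + r))) ^ p) :=
            ENNReal.ofReal_le_ofReal (Real.rpow_le_rpow (norm_nonneg _) hb hp0.le)
        _ = ENNReal.ofReal (((2 : ℝ) ^ (a + r) * C) ^ p * h ^ (r * p)) *
              ENNReal.ofReal (knorm k ^ (-((a + r) * p))) := by
            rw [← ENNReal.ofReal_mul (by positivity)]
            congr 1
            rw [Real.mul_rpow (by positivity) (by positivity), div_rpow_rpow (by positivity) hknn,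
              ← Real.rpow_natCast h r, ← Real.rpow_mul h0.le]
            ring
  -- integrate the majorant
  have hmain : ∫⁻ k in cube (n + 1), ‖sdiff F l h k‖ₑ ^ p ≤
      (∫⁻ k in cube (n + 1), A k) + ∫⁻ k in cube (n + 1), Bf k := by
    calc ∫⁻ k in cube (n + 1), ‖sdiff F l h k‖ₑ ^ p ≤ ∫⁻ k in cube (n + 1), (A k + Bf k) := lintegral_mono_ae hpt
      _ = (∫⁻ k in cube (n + 1), A k) + ∫⁻ k in cube (n + 1), Bf k := by
          refine lintegral_add_right _ ?_
          refine Measurable.indicator ?_ hIm.compl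
          exact measurable_const.mul (ENNReal.measurable_ofReal.comp
            ((hkc.measurable.pow_const _)))
  -- region I integral
  have hψm : ∀ t, Measurable (ψ t) := fun t =>
    ENNReal.measurable_ofReal.comp ((hkc.measurable.comp (measurable_shift l t)).pow_const _)
  have hψI : ∀ t, |t| ≤ h → ∫⁻ k in cube (n + 1) ∩ I, ψ t k ≤
      ENNReal.ofReal ((4 * h) ^ (q - a * p)) * L := fun t ht =>
    lintegral_near_shift_le l h0 hh ht hap hq1
  have hAint : ∫⁻ k in cube (n + 1), A k ≤
      c₁ * (ENNReal.ofReal ((3 * h) ^ (q - a * p)) * L + 2 * (ENNReal.ofReal ((4 * h) ^ (q - a * p)) * L)) := by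
    have hm2 : Measurable fun k => ψ 0 k + ψ h k := (hψm 0).add (hψm h)
    have hc₁t : c₁ ≠ ⊤ := ENNReal.ofReal_ne_top
    rw [hA, lintegral_indicator hIm, Measure.restrict_restrict hIm, Set.inter_comm,
      lintegral_const_mul' _ _ hc₁t, lintegral_add_left hm2, lintegral_add_left (hψm 0)]
    refine mul_le_mul' le_rfl ?_
    -- the unshifted piece by the cube integral with `R = 3h`
    have h1 : ∫⁻ k in cube (n + 1) ∩ I, ψ 0 k ≤ ENNReal.ofReal ((3 * h) ^ (q - a * p)) * L := by
      calc ∫⁻ k in cube (n + 1) ∩ I, ψ 0 k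
          ≤ ∫⁻ k in cube (n + 1) ∩ I, ENNReal.ofReal ((3 * h) ^ (q - a * p)) * ENNReal.ofReal (knorm k ^ (-q)) := by
            refine setLIntegral_mono' ((measurableSet_cube _).inter hIm) fun k hk => ?_
            rw [hψ]; simp only [shift_zero]
            rw [← ENNReal.ofReal_mul (Real.rpow_nonneg (by linarith) _)]
            exact ENNReal.ofReal_le_ofReal (rpow_neg_le_near (knorm_nonneg _) hk.2 hap hq1)
        _ ≤ ENNReal.ofReal ((3 * h) ^ (q - a * p)) * L := by
            rw [lintegral_const_mul' _ _ ENNReal.ofReal_ne_top]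
            exact mul_le_mul' le_rfl (lintegral_mono_set Set.inter_subset_left)
    have h2 := hψI h (abs_of_pos h0).le
    have h3 := hψI (-h) (by rw [abs_neg]; exact (abs_of_pos h0).le)
    calc (∫⁻ k in cube (n + 1) ∩ I, ψ 0 k) + (∫⁻ k in cube (n + 1) ∩ I, ψ h k) + ∫⁻ k in cube (n + 1) ∩ I, ψ (-h) k
        ≤ ENNReal.ofReal ((3 * h) ^ (q - a * p)) * L + ENNReal.ofReal ((4 * h) ^ (q - a * p)) * L +
          ENNReal.ofReal ((4 * h) ^ (q - a * p)) * L := add_le_add (add_le_add h1 h2) h3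
      _ = _ := by rw [two_mul]; ring
  -- region II integral
  have hBint : ∫⁻ k in cube (n + 1), Bf k ≤
      ENNReal.ofReal (((2 : ℝ) ^ (a + r) * C) ^ p * h ^ (r * p)) * (ENNReal.ofReal ((3 * h) ^ (q - (a + r) * p)) * L) := by
    rw [hBf, lintegral_indicator hIm.compl, Measure.restrict_restrict hIm.compl, Set.inter_comm,
      lintegral_const_mul' _ _ ENNReal.ofReal_ne_top]
    refine mul_le_mul' le_rfl ?_
    calc ∫⁻ k in cube (n + 1) ∩ Iᶜ, ENNReal.ofReal (knorm k ^ (-((a + r) * p)))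
        ≤ ∫⁻ k in cube (n + 1) ∩ Iᶜ, ENNReal.ofReal ((3 * h) ^ (q - (a + r) * p)) * ENNReal.ofReal (knorm k ^ (-q)) := by
          refine setLIntegral_mono' ((measurableSet_cube _).inter hIm.compl) fun k hk => ?_
          have hkII : 3 * h ≤ knorm k := not_lt.1 hk.2
          rw [← ENNReal.ofReal_mul (Real.rpow_nonneg (by linarith) _)]
          exact ENNReal.ofReal_le_ofReal (rpow_neg_le_far (by linarith) hkII hq2)
      _ ≤ ENNReal.ofReal ((3 * h) ^ (q - (a + r) * p)) * L := by
          rw [lintegral_const_mul' _ _ ENNReal.ofReal_ne_top]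
          exact mul_le_mul' le_rfl (lintegral_mono_set Set.inter_subset_left)
  -- assemble: every piece is a constant times `h^{q - ap}`
  have hsplit3 : ENNReal.ofReal ((3 * h) ^ (q - a * p)) =
      ENNReal.ofReal ((3 : ℝ) ^ (q - a * p)) * ENNReal.ofReal (h ^ (q - a * p)) := by
    rw [Real.mul_rpow (by norm_num) h0.le, ENNReal.ofReal_mul (Real.rpow_nonneg (by norm_num) _)]
  have hsplit4 : ENNReal.ofReal ((4 * h) ^ (q - a * p)) =
      ENNReal.ofReal ((4 : ℝ) ^ (q - a * p)) * ENNReal.ofReal (h ^ (q - a * p)) := by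
    rw [Real.mul_rpow (by norm_num) h0.le, ENNReal.ofReal_mul (Real.rpow_nonneg (by norm_num) _)]
  have hsplitB : ENNReal.ofReal (((2 : ℝ) ^ (a + r) * C) ^ p * h ^ (r * p)) *
      ENNReal.ofReal ((3 * h) ^ (q - (a + r) * p)) = c₂ * ENNReal.ofReal (h ^ (q - a * p)) := by
    rw [hc₂, ← ENNReal.ofReal_mul (by positivity), ← ENNReal.ofReal_mul (by positivity),
      Real.mul_rpow (by norm_num) h0.le]
    congr 1
    have : h ^ (r * p) * h ^ (q - (a + r) * p) = h ^ (q - a * p) := by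
      rw [← Real.rpow_add h0]; congr 1; ring
    calc ((2 : ℝ) ^ (a + r) * C) ^ p * h ^ (r * p) * ((3 : ℝ) ^ (q - (a + r) * p) * h ^ (q - (a + r) * p))
        = ((2 : ℝ) ^ (a + r) * C) ^ p * (3 : ℝ) ^ (q - (a + r) * p) * (h ^ (r * p) * h ^ (q - (a + r) * p)) := by ring
      _ = _ := by rw [this]
  calc ∫⁻ k in cube (n + 1), ‖sdiff F l h k‖ₑ ^ p
      ≤ (∫⁻ k in cube (n + 1), A k) + ∫⁻ k in cube (n + 1), Bf k := hmain
    _ ≤ c₁ * (ENNReal.ofReal ((3 * h) ^ (q - a * p)) * L + 2 * (ENNReal.ofReal ((4 * h) ^ (q - a * p)) * L)) +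
        ENNReal.ofReal (((2 : ℝ) ^ (a + r) * C) ^ p * h ^ (r * p)) * (ENNReal.ofReal ((3 * h) ^ (q - (a + r) * p)) * L) :=
        add_le_add hAint hBint
    _ = K * ENNReal.ofReal (h ^ (q - a * p)) := by
        rw [hsplit3, hsplit4, ← mul_assoc (ENNReal.ofReal (((2 : ℝ) ^ (a + r) * C) ^ p * h ^ (r * p))), hsplitB, hK]
        ring

/-! ### Summing the dyadic series: countable Minkowski and the geometric tail -/

/-- **Countable Minkowski inequality** in `[0,∞]`: for a.e.-measurable `g_m ≥ 0` and `p ≥ 1`,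
`(∫ (Σ_m g_m)^p)^{1/p} ≤ Σ_m (∫ g_m^p)^{1/p}`. [folklore] -/
theorem lintegral_rpow_tsum_le {α : Type*} [MeasurableSpace α] {μ : Measure α} {g : ℕ → α → ℝ≥0∞}
    (hg : ∀ m, AEMeasurable (g m) μ) {p : ℝ} (hp : 1 ≤ p) :
    (∫⁻ a, (∑' m, g m a) ^ p ∂μ) ^ (1 / p) ≤ ∑' m, (∫⁻ a, g m a ^ p ∂μ) ^ (1 / p) := by
  have hp0 : 0 < p := by linarith
  -- finite sums
  set S : ℕ → α → ℝ≥0∞ := fun N a => ∑ m ∈ Finset.range N, g m a with hS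
  have hSm : ∀ N, AEMeasurable (S N) μ := fun N => Finset.aemeasurable_fun_sum _ fun m _ => hg m
  have hfin : ∀ N, (∫⁻ a, S N a ^ p ∂μ) ^ (1 / p) ≤ ∑ m ∈ Finset.range N, (∫⁻ a, g m a ^ p ∂μ) ^ (1 / p) := by
    intro N
    induction N with
    | zero =>
      simp only [hS, Finset.range_zero, Finset.sum_empty, ENNReal.zero_rpow_of_pos hp0, lintegral_zero,
        ENNReal.zero_rpow_of_pos (one_div_pos.2 hp0), le_refl]
    | succ N ih =>
      have hstep : (∫⁻ a, S (N + 1) a ^ p ∂μ) ^ (1 / p) ≤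
          (∫⁻ a, S N a ^ p ∂μ) ^ (1 / p) + (∫⁻ a, g N a ^ p ∂μ) ^ (1 / p) := by
        have h := ENNReal.lintegral_Lp_add_le (hSm N) (hg N) hp
        have hSN : ∀ a, S (N + 1) a = (S N + g N) a := fun a => by
          simp only [hS, Finset.sum_range_succ, Pi.add_apply]
        simp_rw [hSN]
        exact h
      rw [Finset.sum_range_succ]
      exact hstep.trans (add_le_add ih le_rfl)
  -- pass to the limit
  have hsup : ∀ a, (∑' m, g m a) ^ p = ⨆ N, S N a ^ p := by
    intro a
    rw [ENNReal.tsum_eq_iSup_nat]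
    have := (ENNReal.orderIsoRpow p hp0).map_iSup (fun N => S N a)
    simpa only [ENNReal.orderIsoRpow_apply] using this
  have hmono : ∀ᵐ a ∂μ, Monotone fun N => S N a ^ p := ae_of_all _ fun a => by
    intro N M hNM
    exact ENNReal.rpow_le_rpow (Finset.sum_le_sum_of_subset (Finset.range_mono hNM)) hp0.le
  have hlim : ∫⁻ a, (∑' m, g m a) ^ p ∂μ = ⨆ N, ∫⁻ a, S N a ^ p ∂μ := by
    simp_rw [hsup]
    exact lintegral_iSup' (fun N => (hSm N).pow_const _) hmono
  rw [hlim]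
  have hsup' : (⨆ N, ∫⁻ a, S N a ^ p ∂μ) ^ (1 / p) = ⨆ N, (∫⁻ a, S N a ^ p ∂μ) ^ (1 / p) := by
    have := (ENNReal.orderIsoRpow (1 / p) (one_div_pos.2 hp0)).map_iSup (fun N => ∫⁻ a, S N a ^ p ∂μ)
    simpa only [ENNReal.orderIsoRpow_apply] using this
  rw [hsup']
  exact iSup_le fun N => (hfin N).trans (ENNReal.sum_le_tsum _)

/-- The dyadic-geometric series: for `θ < σ`, `Σ_m 2^{mθ} h_m^σ < ∞` (in `[0,∞]`). [folklore] -/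
theorem tsum_ofReal_two_rpow_mul_step_rpow_lt_top {θ σ : ℝ} (hθσ : θ < σ) :
    ∑' m : ℕ, ENNReal.ofReal ((2 : ℝ) ^ ((m : ℝ) * θ) * step m ^ σ) < ⊤ := by
  have hρ0 : 0 ≤ (2 : ℝ) ^ (θ - σ) := Real.rpow_nonneg (by norm_num) _
  have hρ1 : (2 : ℝ) ^ (θ - σ) < 1 := Real.rpow_lt_one_of_one_lt_of_neg (by norm_num) (by linarith)
  have hterm : ∀ m : ℕ, (2 : ℝ) ^ ((m : ℝ) * θ) * step m ^ σ =
      (Real.pi / 4) ^ σ * ((2 : ℝ) ^ (θ - σ)) ^ m := by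
    intro m
    rw [step_eq, Real.mul_rpow (by positivity) (by positivity), ← Real.rpow_natCast ((2 : ℝ) ^ (θ - σ)) m,
      ← Real.rpow_mul (by norm_num), ← Real.rpow_natCast ((1 : ℝ) / 2) m, ← Real.rpow_mul (by norm_num),
      one_div, Real.inv_rpow (by norm_num), ← Real.rpow_neg (by norm_num),
      show (θ - σ) * (m : ℝ) = (m : ℝ) * θ + -((m : ℝ) * σ) by ring, Real.rpow_add two_pos]
    ring
  simp_rw [hterm]
  have hsum : Summable fun m : ℕ => (Real.pi / 4) ^ σ * ((2 : ℝ) ^ (θ - σ)) ^ m :=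
    (summable_geometric_of_lt_one hρ0 hρ1).mul_left _
  rw [← ENNReal.ofReal_tsum_of_nonneg (fun m => by positivity) hsum]
  exact ENNReal.ofReal_lt_top

/-- A convenient exponent strictly between `(a + θ)p` and `min(d, (a + R)p)`. [folklore] -/
theorem exists_exponent {a θ p d R : ℝ} (h1 : (a + θ) * p < d) (h2 : θ < R) (hp : 0 < p) (hθ : 0 < θ) :
    ∃ q : ℝ, a * p ≤ q ∧ q ≤ (a + R) * p ∧ q < d ∧ θ < (q - a * p) / p := by
  refine ⟨((a + θ) * p + min d ((a + R) * p)) / 2, ?_, ?_, ?_, ?_⟩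
  · have : (a + θ) * p ≤ min d ((a + R) * p) := le_min h1.le (by nlinarith)
    nlinarith
  · have : min d ((a + R) * p) ≤ (a + R) * p := min_le_right _ _
    nlinarith
  · have : min d ((a + R) * p) ≤ d := min_le_left _ _
    linarith
  · rw [lt_div_iff₀ hp]
    have : (a + θ) * p < min d ((a + R) * p) := lt_min h1 (by nlinarith)
    nlinarith

/-- **Weighted `L¹` summability of the dyadic second differences** (the hypothesis of the
representation theorem `IsFourierPair.fracWeight_mul`): under `SliceBound F l a r C` (`r = 1` or `2`,
`a > 0`, `n ≥ 1`), `0 < θ < r` and `a + θ < d`,  `Σ_m 2^{mθ} ∫_{[-π,π]^d} |Δ²_{h_m} F| < ∞`.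
[folklore] -/
theorem tsum_lintegral_sdiff_ne_top (hn : 1 ≤ n) (hF : SliceBound F l a r C) (hr : r = 1 ∨ r = 2)
    (ha : 0 < a) (hC : 0 ≤ C) {θ : ℝ} (hθ0 : 0 < θ) (hθr : θ < r) (hθd : a + θ < n + 1) :
    ∑' m : ℕ, ENNReal.ofReal ((2 : ℝ) ^ ((m : ℝ) * θ)) *
      ∫⁻ k in cube (n + 1), ‖sdiff F l (step m) k‖ₑ ≠ ⊤ := by
  obtain ⟨q, hq1, hq2, hq3, hσ⟩ := exists_exponent (d := (n : ℝ) + 1) (R := (r : ℝ)) (p := 1)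
    (by simpa using hθd) hθr one_pos hθ0
  obtain ⟨K, hK, hKb⟩ := lintegral_rpow_sdiff_le hn hF hr ha hC le_rfl (by simpa using hq1)
    (by simpa using hq2) hq3
  simp only [mul_one, div_one] at hσ hKb
  have hle : ∀ m : ℕ, ENNReal.ofReal ((2 : ℝ) ^ ((m : ℝ) * θ)) * ∫⁻ k in cube (n + 1), ‖sdiff F l (step m) k‖ₑ ≤
      K * ENNReal.ofReal ((2 : ℝ) ^ ((m : ℝ) * θ) * step m ^ (q - a)) := by
    intro m
    have h := hKb (step m) (step_pos m) (step_le m)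
    simp only [ENNReal.rpow_one] at h
    calc ENNReal.ofReal ((2 : ℝ) ^ ((m : ℝ) * θ)) * ∫⁻ k in cube (n + 1), ‖sdiff F l (step m) k‖ₑ
        ≤ ENNReal.ofReal ((2 : ℝ) ^ ((m : ℝ) * θ)) * (K * ENNReal.ofReal (step m ^ (q - a))) :=
          mul_le_mul' le_rfl h
      _ = K * ENNReal.ofReal ((2 : ℝ) ^ ((m : ℝ) * θ) * step m ^ (q - a)) := by
          rw [ENNReal.ofReal_mul (Real.rpow_nonneg (by norm_num) _)]; ring
  refine ne_top_of_le_ne_top ?_ (ENNReal.tsum_le_tsum hle)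
  rw [ENNReal.tsum_mul_left]
  exact ENNReal.mul_ne_top hK (tsum_ofReal_two_rpow_mul_step_rpow_lt_top hσ).ne

/-- The terms of the smear are a.e.-measurable on the cube when the shifts of `F` are. [folklore] -/
theorem aemeasurable_enorm_sdiff {F : (Fin (n + 1) → ℝ) → ℂ} {l : Fin (n + 1)}
    (hmeas : ∀ t : ℝ, AEStronglyMeasurable (fun k => F (shift l t k))
      ((volume : Measure (Fin (n + 1) → ℝ)).restrict (cube (n + 1)))) (h : ℝ) :
    AEMeasurable (fun k => (‖sdiff F l h k‖ₑ : ℝ≥0∞))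
      ((volume : Measure (Fin (n + 1) → ℝ)).restrict (cube (n + 1))) := by
  have h0 : AEStronglyMeasurable F ((volume : Measure (Fin (n + 1) → ℝ)).restrict (cube (n + 1))) := by
    simpa only [shift_zero] using hmeas 0
  have h2 : AEStronglyMeasurable (fun k => (F (shift l h k) + F (shift l (-h) k)) / 2)
      ((volume : Measure (Fin (n + 1) → ℝ)).restrict (cube (n + 1))) := by
    refine (((hmeas h).add (hmeas (-h))).mul_const ((2 : ℂ)⁻¹)).congr (ae_of_all _ fun k => ?_)
    simp only [Pi.add_apply, div_eq_mul_inv]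
  exact (h0.sub h2).enorm

/-- **`T_θ F ∈ L^p([-π,π]^d)`**: under `SliceBound F l a r C` (`r = 1` or `2`, `a > 0`, `n ≥ 1`), for
`p ≥ 1`, `0 < θ < r` and `(a + θ) p < d` — Hara's "finite as long as `2 + n - ε < d`" with
`a + θ = 2 + (n - ε)` — the dyadic smear has `∫_{[-π,π]^d} |T_θ F|^p < ∞`.
[cite: Hara2008, §4.1.3 ((4.16)–(4.17))] -/
theorem lintegral_rpow_smear_lt_top (hn : 1 ≤ n) (hF : SliceBound F l a r C) (hr : r = 1 ∨ r = 2)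
    (ha : 0 < a) (hC : 0 ≤ C) {p : ℝ} (hp : 1 ≤ p) {θ : ℝ} (hθ0 : 0 < θ) (hθr : θ < r)
    (hθd : (a + θ) * p < n + 1)
    (hmeas : ∀ t : ℝ, AEStronglyMeasurable (fun k => F (shift l t k))
      ((volume : Measure (Fin (n + 1) → ℝ)).restrict (cube (n + 1)))) :
    ∫⁻ k in cube (n + 1), ‖smear θ l F k‖ₑ ^ p < ⊤ := by
  have hp0 : 0 < p := by linarith
  obtain ⟨q, hq1, hq2, hq3, hσ⟩ := exists_exponent (d := (n : ℝ) + 1) (R := (r : ℝ)) hθd hθr hp0 hθ0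
  obtain ⟨K, hK, hKb⟩ := lintegral_rpow_sdiff_le hn hF hr ha hC hp hq1 hq2 hq3
  set σ : ℝ := (q - a * p) / p with hσ_def
  -- the terms and their `L^p` norms
  set g : ℕ → (Fin (n + 1) → ℝ) → ℝ≥0∞ := fun m k =>
    ENNReal.ofReal ((2 : ℝ) ^ ((m : ℝ) * θ)) * ‖sdiff F l (step m) k‖ₑ with hg
  have hgm : ∀ m, AEMeasurable (g m) ((volume : Measure (Fin (n + 1) → ℝ)).restrict (cube (n + 1))) :=
    fun m => (aemeasurable_enorm_sdiff hmeas (step m)).const_mul _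
  have hterm : ∀ m, (∫⁻ k in cube (n + 1), g m k ^ p) ^ (1 / p) ≤
      K ^ (1 / p) * ENNReal.ofReal ((2 : ℝ) ^ ((m : ℝ) * θ) * step m ^ σ) := by
    intro m
    have h := hKb (step m) (step_pos m) (step_le m)
    have h2 : ∫⁻ k in cube (n + 1), g m k ^ p =
        ENNReal.ofReal ((2 : ℝ) ^ ((m : ℝ) * θ)) ^ p * ∫⁻ k in cube (n + 1), ‖sdiff F l (step m) k‖ₑ ^ p := by
      simp only [hg]
      simp_rw [ENNReal.mul_rpow_of_nonneg _ _ hp0.le]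
      rw [lintegral_const_mul' _ _ (ENNReal.rpow_ne_top_of_nonneg hp0.le ENNReal.ofReal_ne_top)]
    rw [h2]
    calc (ENNReal.ofReal ((2 : ℝ) ^ ((m : ℝ) * θ)) ^ p * ∫⁻ k in cube (n + 1), ‖sdiff F l (step m) k‖ₑ ^ p) ^ (1 / p)
        ≤ (ENNReal.ofReal ((2 : ℝ) ^ ((m : ℝ) * θ)) ^ p * (K * ENNReal.ofReal (step m ^ (q - a * p)))) ^ (1 / p) :=
          ENNReal.rpow_le_rpow (mul_le_mul' le_rfl h) (by positivity)
      _ = K ^ (1 / p) * ENNReal.ofReal ((2 : ℝ) ^ ((m : ℝ) * θ) * step m ^ σ) := by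
          rw [ENNReal.mul_rpow_of_nonneg _ _ (by positivity : (0 : ℝ) ≤ 1 / p),
            ENNReal.mul_rpow_of_nonneg _ _ (by positivity : (0 : ℝ) ≤ 1 / p),
            ← ENNReal.rpow_mul, mul_one_div_cancel hp0.ne', ENNReal.rpow_one,
            ENNReal.ofReal_rpow_of_nonneg (Real.rpow_nonneg (step_pos m).le _) (by positivity),
            ← Real.rpow_mul (step_pos m).le, ENNReal.ofReal_mul (Real.rpow_nonneg (by norm_num) _)]
          simp only [hσ_def, mul_one_div]
          ring
  -- Minkowski over the series
  have hM := lintegral_rpow_tsum_le hgm hp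
  have hT : ∑' m, (∫⁻ k in cube (n + 1), g m k ^ p) ^ (1 / p) < ⊤ := by
    refine lt_of_le_of_lt (ENNReal.tsum_le_tsum hterm) ?_
    rw [ENNReal.tsum_mul_left]
    exact ENNReal.mul_lt_top (ENNReal.rpow_lt_top_of_nonneg (by positivity) hK)
      (tsum_ofReal_two_rpow_mul_step_rpow_lt_top hσ)
  -- compare the smear with the series of norms
  have hcmp : ∫⁻ k in cube (n + 1), ‖smear θ l F k‖ₑ ^ p ≤ ∫⁻ k in cube (n + 1), (∑' m, g m k) ^ p := by
    refine lintegral_mono fun k => ENNReal.rpow_le_rpow ?_ hp0.le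
    refine (enorm_tsum_le_tsum_enorm).trans (le_of_eq (tsum_congr fun m => ?_))
    rw [hg, enorm_mul, ← ofReal_norm (((2 : ℝ) ^ ((m : ℝ) * θ) : ℝ) : ℂ), Complex.norm_real,
      Real.norm_of_nonneg (Real.rpow_nonneg (by norm_num) _)]
  refine lt_of_le_of_lt hcmp ?_
  have h1 : ∫⁻ k in cube (n + 1), (∑' m, g m k) ^ p ≤ (∑' m, (∫⁻ k in cube (n + 1), g m k ^ p) ^ (1 / p)) ^ p := by
    simpa only [one_div] using (ENNReal.rpow_inv_le_iff hp0).1 (by simpa only [one_div] using hM)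
  exact lt_of_le_of_lt h1 (ENNReal.rpow_lt_top_of_nonneg hp0.le hT.ne)

end FracSmear

end Literature.Barriers.CriticalPhenomena
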